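import Summits.QuantumFields.BalabanUV.Beta.SecondOrderUnits
import Summits.QuantumFields.BalabanUV.Beta.GAN24.StencilSlotOfShapes

/-!
# `BalabanUV.Beta.GAN24.WSlotOfShapes` — binder row G-an2-4 / (CONV-C), AFTER the K-slot and the S-slot: the wall's UNIFORM SECOND-ORDER
# binder `hW` for an2's Stage-A/B family `BalabanStepW2.WbalOf` PROVED AS A FUNCTION OF the K-slot's decay half `UnitDecayK`, «E3Shape», and
# ONE located shape «T2Shape» (the bi-stencil binder family in the adopted units) — the W-slot analogue of gan24-p1's `StencilSlotOfShapes`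

NOT IN PRINT; OUR PROOF ATTEMPT (G-an2-4 formalisation swarm, idle leaf seat `b2b-balaban-gan24-formalise-leaf-07`, gen 11; module name
PROVISIONAL — the row owner gan24-p1 / the (P4) author an2 may rename or re-home it).  HONEST FRAMING (cell contract, verbatim): «discharging
`BetaPertH` makes Bałaban's UV stability UNCONDITIONAL — a real constructive-QFT result; it is NOT the continuum limit and NOT the Clay problem.»
HONEST DEPENDENCY (verbatim): «continuum YM on T⁴ ⇐ BetaPertH ∧ nine spine estimates (0/9 proved); BetaPertH ⇐ (D1) ∧ (D4) ∧ CAP+tail;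
G-an2-4 gates asym, D1 and NE2/3/4.»  [folklore] bookkeeping: composition of an4's `SecondOrderUnits.unitW_WbalOf` (the normalised second-order
family is an2's SAME carrier `W2SymOfK` over the normalised kernel and tables) with an2's EXPLICIT-CONSTANT vertex-family bound
`SecondOrderResponse.vertexFamily₂_W2SymOfK` (constant `CW2 …`, rate `m/16`), gan24-p1's `StencilSlotVH.locStencil_unitS_vhPiece` and
`StencilSlotOfShapes.unitS_add/unitS_step_zero`; no estimate, no cited fact, no `def`, no `Prop` mirror.  Two EXPONENT CHECKS of an2's
provisional (P4) numerals against the K-slot units `(sfStep Lc j, smStep d Lc j) = (Lc^j, Lc^{j(d+1)})` are kernel identities here: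
`wM1 j = (Lc^j)^{2(d+2)}` makes the normalised multiplier table `j`-FREE (`unitM_M1_eq`), `wM2 j = (Lc^j)^{3(d+2)}` makes the normalised
mixed table `j`-FREE on field–field-valued binders (`unitM₂_M2Of_eq`; an1's `mixFFAt` IS field–field-valued by definition) — the W-side
twins of gan24-p1's (U-S1) `StencilSlotVH.unitS_vhPiece_eq`.
NOTHING of the wall is discharged here: its binder `hW` is concluded only FROM the hypotheses «T2Shape» (the `j`-uniform `LocStencil₂`
locality of the NORMALISED bi-stencil tables `unitS₂ (sfStep Lc j) (smStep d Lc j) (T₂ j)` — for an2's Stage-B `T2Of` this is the recursive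
value 4-jet `e4OfW` + `wilsonW₂` + the `vh₂S` border: NOT IN PRINT for the typed objects, OPEN, asserted nowhere), «E3Shape» (for `d = 3` a
tree theorem, `StencilSlotSThree.e3Shape_three` — not imported, the file stays generic in `d`), `UnitDecayK` (= the wall's own `hK`; for
`d = 3` a theorem of road P1 through `KSlotAssembly.convCKWall_holds`) and the `LocStencilFM` shape + field–field support of the mixed binder
table `mixFF`.  The Cauchy half `hWall`, the S-rows and the identification are untouched.  K 2/2, S 2/2 wall binders are tree theorems at `d = 3`, `Lc ≥ 2`
(`KSlotAssembly.convCKWall_holds`; `StencilSlotSAllThree.hS_hSall_three`), W 2/2 AT THE DISPLAYED PIN `cE₂ = +Lc^(2(3+1))` at every box root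
(`WSlotT2Tables.hW_hWall_three_an1_pinned`, `WSlotT2TablesAn1.hW_hWall_three_an1At_pinned`) and W 0/2 for the `BetaPertH` wall literal until
(P6)/(R45) — accounting of record ref2 r89 R89-1; THIS module: reduction only, it instantiates none of them.  NOT summit progress.

v1.1 DOCFIX (2026-08-20; orphan adoption by the idle leaf seat `b2b-balaban-gan24-formalise-leaf-01` gen 35 — the author lineage
`b2b-balaban-gan24-formalise-leaf-07` is retired): referee-2 objection G-gan24ref2-4 (GAPS.md, round 49; 22 notices through round 89) — the
module docstring's v1 phrase counting the instantiated wall binders as zero (FALSE since rounds 23/45: the wall's K- and S-pairs ARE tree theorems) is replaced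
above by the accounting of record; every declaration of v1 (p209355) is byte-identical, no import change.

## What is proved (generic `d`; `Lc` with `NeZero Lc`, `1 ≤ Lc` where stated)
* §1 (U-W) unit checks: `m1_unit_factor`, **`unitM_M1_eq`** (`unitM (sfStep Lc j) (smStep d Lc j) (M1 d Lc cΛ j) = fun ρ w ↦ cΛ • hessFF Lc ρ w`,
  every `j`), `vertexFamily_unitM_M1` (one `j`-free constant at any rate `δ ≥ 0`); `m2_unit_factor`, **`unitM₂_M2Of_eq`** (`unitM₂ (sfStep Lc j)
  (smStep d Lc j) (M2Of d Lc mixFF j) = mixFF` for field–field-valued `mixFF`), `locStencilFM_unitM₂_M2Of`.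
* §2 the normalised FIRST field table of the Lagrangian chart: `unitS_Spure_succ_eq` (member `j+1` = normalised E‴ piece + normalised (V-H)
  piece), **`locStencil_unitS_Spure`** (`«E3Shape» C₃ δ₃ → 0 < δ₃ → ∃ Cs δs, 0 < δs ∧ ∀ j, LocStencil (unitS (sfStep Lc j) (smStep d Lc j) (Spure … j)) Cs δs`).
* §3 **`hW_of_shapes`** — THE WALL'S UNIFORM W-BINDER SHAPE for `WbalOf`:
  `UnitDecayK d Lc (sfStep Lc) (smStep d Lc) C δ → 0 < δ → «E3Shape» C₃ δ₃ → 0 < δ₃ → «T2Shape» C₂ δ₂ → 0 < δ₂ → LocStencilFM Lc mixFF CM₂ δ₄ →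
  0 < δ₄ → (mixFF field–field-valued) → ∃ Cw δW, 0 < δW ∧ ∀ j, VertexFamily₂ (unitW (sfStep Lc j) (smStep d Lc j) (WbalOf d Lc cE cVH cΛ T₂ mixFF j)) Lc Cw δW`
  — LITERALLY the hypothesis `hW` of `HessKerDressedUnitsWall.d1Drift_JsBalOf_iff_of_cauchy_unit` (and, with `hδW`, the pair `hW₂`/`hδW` of
  `GAN24/StencilSlotWallThree.d1Drift_JsBalOf_iff_three_of_diffRows`) at `sf := sfStep Lc`, `sm := smStep d Lc`, `W := WbalOf d Lc cE cVH cΛ T₂ mixFF`.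
So the W-slot's uniform half reads: `hW ⇐ hK ∧ E3Shape ∧ T2Shape ∧ (mixFF shape)` in the kernel; at `d = 3` the first two are tree theorems
(see the companion corollary module), and what remains located for `hW` is «T2Shape» alone.
-/

noncomputable section

open Literature.MathematicalPhysics.QuantumFieldTheory
open Literature.MathematicalPhysics.QuantumFieldTheory.Balaban1983to89
open Literature.MathematicalPhysics.QuantumFieldTheory.Balaban1983to89.Beta
open ExpKernelCalculus (MKer Decays BiLoc VertexFamily VertexFamily₂)
open OneStepResolventKernel (Fib LocStencil)
open OneStepKernelFamily (KInvStep)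
open AveragingHessianKernels (vhS hessFF ell biLoc_hessFF hessFF_inl_inr hessFF_inr)
open StepJetData (mfNeg)
open BalabanStepJetsSucc (wE wVH e3Of)
open BalabanCompositeJets (LocStencil₂)
open SecondOrderResponse (W2SymOfK LocStencilFM CW2 vertexFamily₂_W2SymOfK)
open BalabanStepW2 (wM1 wM2 Spure M1 M2Of WbalOf Spure_zero Spure_succ locStencil_Spure)
open Summit.QuantumFields.BalabanUV.Beta.HessKerDressedUnits (unitK unitS unitW legScale unitS_apply legScale_inl legScale_inr)
open Summit.QuantumFields.BalabanUV.Beta.SecondOrderUnits (unitM unitS₂ unitM₂ unitM_apply unitW_WbalOf)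
open Summit.QuantumFields.BalabanUV.Beta.GAN24.CombesThomas (sfStep smStep UnitDecayK sfStep_ne_zero smStep_ne_zero)
open Summit.QuantumFields.BalabanUV.Beta.GAN24.StencilSlotVH (locStencil_unitS_vhPiece)
open Summit.QuantumFields.BalabanUV.Beta.GAN24.StencilSlotOfShapes (unitS_add unitS_step_zero locStencil_mono')

namespace Summit.QuantumFields.BalabanUV.Beta.GAN24.WSlotOfShapes

variable {d : ℕ} {Lc : ℕ} [NeZero Lc]

/-! ## §1 (U-W) exponent checks: an2's multiplier-table weights against the K-slot units — both normalised tables are `j`-FREE -/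

/-- [folklore] **(U-W-M1)** `(s_m s_m)⁻¹ · (s_f⁻¹ s_f⁻¹) · wM1 j = 1` at `(s_f, s_m) = (Lc^j, Lc^{j(d+1)})`: the exponent count
`−2j(d+1) − 2j + 2j(d+2) = 0`. -/
theorem m1_unit_factor (j : ℕ) :
    (smStep d Lc j * smStep d Lc j)⁻¹ * ((sfStep Lc j)⁻¹ * (sfStep Lc j)⁻¹) * wM1 d Lc j = 1 := by
  have hL : (Lc : ℝ) ≠ 0 := Nat.cast_ne_zero.2 (NeZero.ne Lc)
  have h1 : smStep d Lc j * smStep d Lc j * (sfStep Lc j * sfStep Lc j) = wM1 d Lc j := by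
    simp only [sfStep, smStep, wM1, ← pow_add, ← pow_mul]
    ring_nf
  have hne : smStep d Lc j * smStep d Lc j * (sfStep Lc j * sfStep Lc j) ≠ 0 := by
    rw [h1]; simp only [wM1]; exact pow_ne_zero _ (pow_ne_zero _ hL)
  rw [← h1, ← mul_inv, ← mul_inv]
  exact inv_mul_cancel₀ hne

/-- [folklore] **THE NORMALISED MULTIPLIER TABLE IS `j`-INDEPENDENT**: in the K-slot's units, an2's first multiplier table `M1 j` (weight
`wM1 j = (Lc^j)^{2(d+2)}` on an1's field–field-valued constraint Hessian `hessFF`) reads `cΛ • hessFF Lc ρ w` for EVERY `j`. -/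
theorem unitM_M1_eq (cΛ : ℝ) (j : ℕ) :
    unitM (sfStep Lc j) (smStep d Lc j) (M1 d Lc cΛ j) = fun ρ w => cΛ • hessFF Lc ρ w := by
  have hfac := m1_unit_factor (d := d) (Lc := Lc) j
  funext ρ w x z a b
  simp only [unitM_apply, M1, Pi.smul_apply, smul_eq_mul]
  rcases a with α | μ <;> rcases b with β | ν
  · rw [legScale_inl, legScale_inl]
    calc (smStep d Lc j * smStep d Lc j)⁻¹ *
          ((sfStep Lc j)⁻¹ * (cΛ * wM1 d Lc j * hessFF Lc ρ w x z (Sum.inl α) (Sum.inl β)) * (sfStep Lc j)⁻¹)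
        = ((smStep d Lc j * smStep d Lc j)⁻¹ * ((sfStep Lc j)⁻¹ * (sfStep Lc j)⁻¹) * wM1 d Lc j) *
            (cΛ * hessFF Lc ρ w x z (Sum.inl α) (Sum.inl β)) := by ring
      _ = cΛ * hessFF Lc ρ w x z (Sum.inl α) (Sum.inl β) := by rw [hfac, one_mul]
  · simp only [hessFF_inl_inr, mul_zero, zero_mul]
  · simp only [hessFF_inr, mul_zero, zero_mul]
  · simp only [hessFF_inr, mul_zero, zero_mul]

/-- [folklore] The normalised multiplier table is member `0` of the family (`wM1 0 = 1`). -/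
theorem unitM_M1_eq_zero (cΛ : ℝ) (j : ℕ) :
    unitM (sfStep Lc j) (smStep d Lc j) (M1 d Lc cΛ j) = M1 d Lc cΛ 0 := by
  rw [unitM_M1_eq]
  funext ρ w
  simp only [M1, wM1, pow_zero, one_pow, mul_one]

omit [NeZero Lc] in
/-- [folklore] an1's constraint Hessian with a colour weight is a vertex family at blocking `Lc`, at ANY rate `δ ≥ 0` (`biLoc_hessFF`). -/
theorem vertexFamily_smul_hessFF (hLc : 1 ≤ Lc) (cΛ : ℝ) {δ : ℝ} (hδ : 0 ≤ δ) :
    VertexFamily (fun ρ w => cΛ • hessFF (d := d) Lc ρ w) Lc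
      (|cΛ| * (2 * (ell (d + 1) Lc : ℝ) ^ 2 * Real.exp (4 * ((d : ℝ) + 1) * Lc * δ))) δ :=
  fun ρ w => SecondOrderResponse.biLoc_smul cΛ (biLoc_hessFF hLc ρ w hδ)

/-- [folklore] **`j`-UNIFORM VERTEX-FAMILY BOUND OF THE NORMALISED MULTIPLIER TABLES** at any rate `δ ≥ 0`, ONE `j`-free constant
`|cΛ|·2ℓ²·e^{4(d+1)Lc·δ}`. -/
theorem vertexFamily_unitM_M1 (hLc : 1 ≤ Lc) (cΛ : ℝ) {δ : ℝ} (hδ : 0 ≤ δ) (j : ℕ) :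
    VertexFamily (unitM (sfStep Lc j) (smStep d Lc j) (M1 d Lc cΛ j)) Lc
      (|cΛ| * (2 * (ell (d + 1) Lc : ℝ) ^ 2 * Real.exp (4 * ((d : ℝ) + 1) * Lc * δ))) δ := by
  rw [unitM_M1_eq]
  exact vertexFamily_smul_hessFF hLc cΛ hδ

/-- [folklore] **(U-W-M2)** `(s_f s_m)⁻¹ · (s_m s_m)⁻¹ · (s_f⁻¹ s_f⁻¹) · wM2 j = 1` at `(s_f, s_m) = (Lc^j, Lc^{j(d+1)})`: the exponent count
`−j(d+2) − 2j(d+1) − 2j + 3j(d+2) = 0`. -/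
theorem m2_unit_factor (j : ℕ) :
    (sfStep Lc j * smStep d Lc j)⁻¹ * ((smStep d Lc j * smStep d Lc j)⁻¹ * ((sfStep Lc j)⁻¹ * (sfStep Lc j)⁻¹)) * wM2 d Lc j = 1 := by
  have hL : (Lc : ℝ) ≠ 0 := Nat.cast_ne_zero.2 (NeZero.ne Lc)
  have h1 : sfStep Lc j * smStep d Lc j * (smStep d Lc j * smStep d Lc j * (sfStep Lc j * sfStep Lc j)) = wM2 d Lc j := by
    simp only [sfStep, smStep, wM2, ← pow_add, ← pow_mul]
    ring_nf
  have hne : sfStep Lc j * smStep d Lc j * (smStep d Lc j * smStep d Lc j * (sfStep Lc j * sfStep Lc j)) ≠ 0 := by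
    rw [h1]; simp only [wM2]; exact pow_ne_zero _ (pow_ne_zero _ hL)
  rw [← h1, ← mul_inv, ← mul_inv, ← mul_inv]
  exact inv_mul_cancel₀ hne

/-- [folklore] **THE NORMALISED MIXED TABLE IS `j`-INDEPENDENT** on field–field-valued binders: in the K-slot's units, an2's weighted mixed
table `M2Of mixFF j` (weight `wM2 j = (Lc^j)^{3(d+2)}`) reads `mixFF` itself for EVERY `j`, provided the binder table vanishes off the
field–field block (an1's `AveragingMixedJetTables.mixFFAt` does, by definition: `mixFFAt_inl_inr`, `mixFFAt_inr`). -/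
theorem unitM₂_M2Of_eq {mixFF : Fin (d + 1) → (Fin (d + 1) → ℤ) → Fin (d + 1) → (Fin (d + 1) → ℤ) → MKer (d + 1) (Fib d)}
    (hfm : ∀ κ u ρ w x z (α μ' : Fin (d + 1)), mixFF κ u ρ w x z (Sum.inl α) (Sum.inr μ') = 0)
    (hm : ∀ κ u ρ w x z (μ' : Fin (d + 1)) (b : Fib d), mixFF κ u ρ w x z (Sum.inr μ') b = 0) (j : ℕ) :
    unitM₂ (sfStep Lc j) (smStep d Lc j) (M2Of d Lc mixFF j) = mixFF := by
  have hfac := m2_unit_factor (d := d) (Lc := Lc) j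
  funext κ u ρ w x z a b
  show ((sfStep Lc j * smStep d Lc j)⁻¹ • unitM (sfStep Lc j) (smStep d Lc j) (M2Of d Lc mixFF j κ u)) ρ w x z a b = _
  simp only [unitM_apply, M2Of, Pi.smul_apply, smul_eq_mul]
  rcases a with α | μ' <;> rcases b with β | ν
  · rw [legScale_inl, legScale_inl]
    calc (sfStep Lc j * smStep d Lc j)⁻¹ * ((smStep d Lc j * smStep d Lc j)⁻¹ *
          ((sfStep Lc j)⁻¹ * (wM2 d Lc j * mixFF κ u ρ w x z (Sum.inl α) (Sum.inl β)) * (sfStep Lc j)⁻¹))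
        = ((sfStep Lc j * smStep d Lc j)⁻¹ * ((smStep d Lc j * smStep d Lc j)⁻¹ * ((sfStep Lc j)⁻¹ * (sfStep Lc j)⁻¹)) *
            wM2 d Lc j) * mixFF κ u ρ w x z (Sum.inl α) (Sum.inl β) := by ring
      _ = mixFF κ u ρ w x z (Sum.inl α) (Sum.inl β) := by rw [hfac, one_mul]
  · rw [hfm]; simp only [mul_zero, zero_mul]
  · rw [hm]; simp only [mul_zero, zero_mul]
  · rw [hm]; simp only [mul_zero, zero_mul]

/-- [folklore] **`j`-UNIFORM `LocStencilFM` SHAPE OF THE NORMALISED MIXED TABLES**: the binder's own shape, SAME constant and rate, every `j`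
(field–field-valued binders). -/
theorem locStencilFM_unitM₂_M2Of {mixFF : Fin (d + 1) → (Fin (d + 1) → ℤ) → Fin (d + 1) → (Fin (d + 1) → ℤ) → MKer (d + 1) (Fib d)}
    {C δ : ℝ} (h : LocStencilFM Lc mixFF C δ)
    (hfm : ∀ κ u ρ w x z (α μ' : Fin (d + 1)), mixFF κ u ρ w x z (Sum.inl α) (Sum.inr μ') = 0)
    (hm : ∀ κ u ρ w x z (μ' : Fin (d + 1)) (b : Fib d), mixFF κ u ρ w x z (Sum.inr μ') b = 0) (j : ℕ) :
    LocStencilFM Lc (unitM₂ (sfStep Lc j) (smStep d Lc j) (M2Of d Lc mixFF j)) C δ := by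
  rw [unitM₂_M2Of_eq hfm hm]
  exact h

/-! ## §2 The normalised first FIELD table `Spure` of the Lagrangian chart: «E3Shape» + the `j`-free (V-H) piece -/

/-- [folklore] Member `j+1` of `Spure`, normalised, is the SUM of its two normalised summands (`Spure_succ` by `rfl`, `unitS_add`). -/
theorem unitS_Spure_succ_eq (cE cVH cΛ : ℝ) (j : ℕ) :
    unitS (sfStep Lc (j + 1)) (smStep d Lc (j + 1)) (Spure d Lc cE cVH cΛ (j + 1)) = fun κ u =>
      unitS (sfStep Lc (j + 1)) (smStep d Lc (j + 1)) (fun κ u => (cE * wE d Lc (j + 1)) • e3Of d Lc cE cVH cΛ (j + 1) κ u) κ u +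
      unitS (sfStep Lc (j + 1)) (smStep d Lc (j + 1)) (fun κ u => (cVH * wVH d Lc (j + 1)) • mfNeg (vhS d Lc κ u)) κ u := by
  have h : Spure d Lc cE cVH cΛ (j + 1) = fun κ u =>
      (fun κ u => (cE * wE d Lc (j + 1)) • e3Of d Lc cE cVH cΛ (j + 1) κ u) κ u +
        (fun κ u => (cVH * wVH d Lc (j + 1)) • mfNeg (vhS d Lc κ u)) κ u := rfl
  rw [h, unitS_add]

/-- [folklore] **MEMBERS `≥ 1`: `j`-UNIFORM LOCALITY OF THE NORMALISED `Spure`** from «E3Shape» and gan24-p1's `j`-free (V-H) piece: ONE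
constant `C₃ + |cVH|·3ℓ²e^{4(d+1)Lc·δ₃}`, the rate `δ₃` of «E3Shape». -/
theorem locStencil_unitS_Spure_succ (hLc : 1 ≤ Lc) {cE cVH cΛ C₃ δ₃ : ℝ}
    (hE3 : ∀ j : ℕ, LocStencil (unitS (sfStep Lc (j + 1)) (smStep d Lc (j + 1))
      (fun κ u => (cE * wE d Lc (j + 1)) • e3Of d Lc cE cVH cΛ (j + 1) κ u)) C₃ δ₃) (hδ₃ : 0 < δ₃) (j : ℕ) :
    LocStencil (unitS (sfStep Lc (j + 1)) (smStep d Lc (j + 1)) (Spure d Lc cE cVH cΛ (j + 1)))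
      (C₃ + |cVH| * (3 * (ell (d + 1) Lc : ℝ) ^ 2 * Real.exp (4 * ((d : ℝ) + 1) * Lc * δ₃))) δ₃ := by
  rw [unitS_Spure_succ_eq]
  exact StepJetData.locStencil_add (hE3 j) (locStencil_unitS_vhPiece (d := d) hLc cVH hδ₃.le (j + 1))

/-- [folklore] **THE WHOLE NORMALISED FAMILY `Spure`** (member `0` = `cE • wilsonA + cVH • mfNeg vhS` read in unit `1`, joining with its own
constant from an2's `locStencil_Spure 0`): «E3Shape» `C₃ δ₃ → 0 < δ₃ → ∃ Cs δs, 0 < δs ∧ ∀ j, LocStencil (unitS_j (Spure … j)) Cs δs`. -/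
theorem locStencil_unitS_Spure (hLc : 1 ≤ Lc) {cE cVH cΛ C₃ δ₃ : ℝ}
    (hE3 : ∀ j : ℕ, LocStencil (unitS (sfStep Lc (j + 1)) (smStep d Lc (j + 1))
      (fun κ u => (cE * wE d Lc (j + 1)) • e3Of d Lc cE cVH cΛ (j + 1) κ u)) C₃ δ₃) (hδ₃ : 0 < δ₃) :
    ∃ Cs δs : ℝ, 0 < δs ∧ ∀ j, LocStencil (unitS (sfStep Lc j) (smStep d Lc j) (Spure d Lc cE cVH cΛ j)) Cs δs := by
  obtain ⟨C₀, δ₀, hδ₀, h0⟩ := locStencil_Spure (d := d) (Lc := Lc) hLc cE cVH cΛ 0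
  have hC₀ : 0 ≤ C₀ := (h0 0 0).nonneg (Sum.inl 0)
  set C₁ : ℝ := C₃ + |cVH| * (3 * (ell (d + 1) Lc : ℝ) ^ 2 * Real.exp (4 * ((d : ℝ) + 1) * Lc * δ₃)) with hC₁
  have hsucc : ∀ j, LocStencil (unitS (sfStep Lc (j + 1)) (smStep d Lc (j + 1)) (Spure d Lc cE cVH cΛ (j + 1))) C₁ δ₃ :=
    fun j => locStencil_unitS_Spure_succ hLc hE3 hδ₃ j
  have hC₁0 : 0 ≤ C₁ := ((hsucc 0) 0 0).nonneg (Sum.inl 0)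
  refine ⟨max C₀ C₁, min δ₀ δ₃, lt_min hδ₀ hδ₃, fun j => ?_⟩
  cases j with
  | zero =>
      rw [unitS_step_zero]
      exact locStencil_mono' h0 (le_max_left _ _) (min_le_left _ _)
  | succ j =>
      exact locStencil_mono' (hsucc j) (le_max_right _ _) (min_le_right _ _)

/-! ## §3 The wall's uniform W-binder `hW` for an2's family `WbalOf`, from the K-slot and the three table shapes -/

/-- **THE W-SLOT's UNIFORM HALF AS A FUNCTION OF THE K-SLOT, «E3Shape», «T2Shape» AND THE MIXED-TABLE SHAPE** [folklore assembly]: from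
the wall's own `hK` in the adopted units (`UnitDecayK d Lc (sfStep Lc) (smStep d Lc) C δ`, `0 < δ`), «E3Shape» (`hE3`, `0 < δ₃`), the located
shape «T2Shape» (`hT₂` : the NORMALISED bi-stencil binder tables `unitS₂ (sfStep Lc j) (smStep d Lc j) (T₂ j)` form a `LocStencil₂` family
with ONE constant `C₂` and ONE rate `δ₂ > 0` along the tower — asserted nowhere), and the mixed binder table's own `LocStencilFM Lc mixFF CM₂ δ₄`
(`0 < δ₄`) with field–field support:
`∃ Cw δW, 0 < δW ∧ ∀ j, VertexFamily₂ (unitW (sfStep Lc j) (smStep d Lc j) (WbalOf d Lc cE cVH cΛ T₂ mixFF j)) Lc Cw δW` —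
LITERALLY the binder `hW` of `HessKerDressedUnitsWall.d1Drift_JsBalOf_iff_of_cauchy_unit` at `sf := sfStep Lc`, `sm := smStep d Lc` for
the family `W := WbalOf d Lc cE cVH cΛ T₂ mixFF`.  Route: `SecondOrderUnits.unitW_WbalOf` (the normalised member `j` IS `W2SymOfK` over the
normalised kernel and tables) + `SecondOrderResponse.vertexFamily₂_W2SymOfK` (explicit constant `CW2 d C Cs CM C₂ CM₂ m`, rate `m/16`, at the
common rate `m := min (min (min δ δs) δ₂) δ₄`) + §1–§2. -/
theorem hW_of_shapes (hLc : 1 ≤ Lc) {C δ : ℝ} (hK : UnitDecayK d Lc (sfStep Lc) (smStep d Lc) C δ) (hδ : 0 < δ)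
    {cE cVH cΛ C₃ δ₃ : ℝ}
    (hE3 : ∀ j : ℕ, LocStencil (unitS (sfStep Lc (j + 1)) (smStep d Lc (j + 1))
      (fun κ u => (cE * wE d Lc (j + 1)) • e3Of d Lc cE cVH cΛ (j + 1) κ u)) C₃ δ₃) (hδ₃ : 0 < δ₃)
    {T₂ : ℕ → Fin (d + 1) → (Fin (d + 1) → ℤ) → Fin (d + 1) → (Fin (d + 1) → ℤ) → MKer (d + 1) (Fib d)} {C₂ δ₂ : ℝ}
    (hT₂ : ∀ j, LocStencil₂ (unitS₂ (sfStep Lc j) (smStep d Lc j) (T₂ j)) C₂ δ₂) (hδ₂ : 0 < δ₂)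
    {mixFF : Fin (d + 1) → (Fin (d + 1) → ℤ) → Fin (d + 1) → (Fin (d + 1) → ℤ) → MKer (d + 1) (Fib d)} {CM₂ δ₄ : ℝ}
    (hmix : LocStencilFM Lc mixFF CM₂ δ₄) (hδ₄ : 0 < δ₄)
    (hfm : ∀ κ u ρ w x z (α μ' : Fin (d + 1)), mixFF κ u ρ w x z (Sum.inl α) (Sum.inr μ') = 0)
    (hm : ∀ κ u ρ w x z (μ' : Fin (d + 1)) (b : Fib d), mixFF κ u ρ w x z (Sum.inr μ') b = 0) :
    ∃ Cw δW : ℝ, 0 < δW ∧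
      ∀ j, VertexFamily₂ (unitW (sfStep Lc j) (smStep d Lc j) (WbalOf d Lc cE cVH cΛ T₂ mixFF j)) Lc Cw δW := by
  obtain ⟨Cs, δs, hδs, hS⟩ := locStencil_unitS_Spure (d := d) (Lc := Lc) hLc hE3 hδ₃
  have hC : 0 ≤ C := (hK 0).nonneg (Sum.inl 0)
  have hCs : 0 ≤ Cs := ((hS 0) 0 0).nonneg (Sum.inl 0)
  -- the common rate
  set m : ℝ := min (min (min δ δs) δ₂) δ₄ with hm_def
  have hm0 : 0 < m := lt_min (lt_min (lt_min hδ hδs) hδ₂) hδ₄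
  have hm4 : m ≤ δ₄ := min_le_right _ _
  have hm2 : m ≤ δ₂ := (min_le_left _ _).trans (min_le_right _ _)
  have hms : m ≤ δs := (min_le_left _ _).trans ((min_le_left _ _).trans (min_le_right _ _))
  have hmK : m ≤ δ := (min_le_left _ _).trans ((min_le_left _ _).trans (min_le_left _ _))
  -- the `j`-free multiplier-table constant at the common rate
  set CM : ℝ := |cΛ| * (2 * (ell (d + 1) Lc : ℝ) ^ 2 * Real.exp (4 * ((d : ℝ) + 1) * Lc * m)) with hCM_def
  refine ⟨CW2 d C Cs CM C₂ CM₂ m, m / 16, by positivity, fun j => ?_⟩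
  have hK' : Decays (unitK (sfStep Lc j) (smStep d Lc j) (KInvStep (d := d) Lc j)) C m :=
    OneStepResolventKernel.decays_mono (hK j) hC le_rfl hmK
  have hS' : LocStencil (unitS (sfStep Lc j) (smStep d Lc j) (Spure d Lc cE cVH cΛ j)) Cs m :=
    BalabanStepJets.locStencil_mono (hS j) hCs hms
  have hM' : VertexFamily (unitM (sfStep Lc j) (smStep d Lc j) (M1 d Lc cΛ j)) Lc CM m :=
    vertexFamily_unitM_M1 hLc cΛ hm0.le j
  have hT' : LocStencil₂ (unitS₂ (sfStep Lc j) (smStep d Lc j) (T₂ j)) C₂ m := (hT₂ j).mono hm2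
  have hX' : LocStencilFM Lc (unitM₂ (sfStep Lc j) (smStep d Lc j) (M2Of d Lc mixFF j)) CM₂ m :=
    (locStencilFM_unitM₂_M2Of hmix hfm hm j).mono hm4
  rw [unitW_WbalOf d Lc (sfStep_ne_zero j) (smStep_ne_zero j)]
  exact vertexFamily₂_W2SymOfK hK' hC hm0 hS' hM' hT' hX'

end Summit.QuantumFields.BalabanUV.Beta.GAN24.WSlotOfShapes

end
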